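import Mathlib
import Summits.ValiantsHypothesis.ValiantsHypothesis.Theorems.LacunarySymmetroidMatrixDescartesStubDiagonalSector

/-!
# Crux `MatrixDescartes` (stmt-ValiantsHypothesis-18050), line `Lift` — stub `stub_commutingSector`

The COMMUTING SECTOR of the matrix Descartes rule, in positive-root currency: for pairwise
commuting real symmetric matrices `S₀, …, S_{K-1}` of size `m` and exponents
`d₀, …, d_{K-1}`, the lacunary symmetric pencil `det (∑ₗ X^{dₗ} Sₗ)` has at most `m (K - 1)`
distinct positive real zeros.

Proof.
* `StubCommutingSector.exists_jointEigenmatrix`: pairwise commuting real symmetric matrices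
  are simultaneously diagonalisable.  The maps `toEuclideanLin (S l)` are symmetric
  (`Matrix.isSymmetric_toEuclideanLin_iff`, `Matrix.isHermitian_iff_isSymm`) and pairwise
  commute, so by Mathlib's `LinearMap.IsSymmetric.directSum_isInternal_of_pairwise_commute`
  Euclidean space is the internal direct sum of the joint eigenspaces; collecting bases of the
  joint eigenspaces (`DirectSum.IsInternal.collectedBasis`) gives a basis of joint
  eigenvectors, i.e. an invertible real matrix `U` (columns = the basis vectors) with
  `S l * U = U * diagonal (γ l)` for every `l`.
* `StubCommutingSector.det_pencil_eq_of_intertwine`: mapping through `Polynomial.C`,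
  `(∑ₗ X^{dₗ} Sₗ) · U = U · (∑ₗ X^{dₗ} diagonal (γ l))`; taking determinants, the nonzero
  constant `det U` cancels in `ℝ[X]`, so the two pencils have the same determinant.
* the diagonal pencil is the landed diagonal sector `stub_diagonalSector` (tree file
  `LacunarySymmetroidMatrixDescartesStubDiagonalSector`, imported): its determinant is
  `∏ᵢ (∑ₗ γ l i X^{dₗ})`, a product of `m` polynomials with at most `K` monomials each, so the
  sparse Descartes rule gives at most `m (K - 1)` distinct positive zeros.

Mathlib + the tree's diagonal sector only (axioms `propext`, `Classical.choice`, `Quot.sound`).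
-/

-- layout Summits/ValiantsHypothesis/ValiantsHypothesis forces the duplicated namespace component
set_option linter.dupNamespace false

namespace Summit.ValiantsHypothesis.ValiantsHypothesis.Theorems.LacunarySymmetroidMatrixDescartes

open Polynomial Matrix Finset
open scoped BigOperators

namespace StubCommutingSector

/-- Intertwined pencils have the same determinant: if `U` is invertible and `Sₗ U = U Dₗ` for
every `l`, then `det (∑ₗ X^{dₗ} Sₗ) = det (∑ₗ X^{dₗ} Dₗ)` (map the intertwining relation through
`Polynomial.C`, take determinants, and cancel the nonzero constant `det U` in `ℝ[X]`). -/
theorem det_pencil_eq_of_intertwine {K m : ℕ} (d : Fin K → ℕ)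
    (S D : Fin K → Matrix (Fin m) (Fin m) ℝ) (U : Matrix (Fin m) (Fin m) ℝ) (hU : IsUnit U)
    (hSU : ∀ l, S l * U = U * D l) :
    Matrix.det (∑ l, ((Polynomial.X : Polynomial ℝ) ^ d l) • (S l).map Polynomial.C)
      = Matrix.det (∑ l, ((Polynomial.X : Polynomial ℝ) ^ d l) • (D l).map Polynomial.C) := by
  have hdetC : (U.map Polynomial.C).det = Polynomial.C U.det := by
    rw [RingHom.map_det, RingHom.mapMatrix_apply]
  have hdet : (U.map Polynomial.C).det ≠ 0 := by
    rw [hdetC]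
    exact Polynomial.C_ne_zero.mpr ((Matrix.isUnit_iff_isUnit_det U).mp hU).ne_zero
  have key :
      (∑ l, ((Polynomial.X : Polynomial ℝ) ^ d l) • (S l).map Polynomial.C) * U.map Polynomial.C
        = U.map Polynomial.C *
          ∑ l, ((Polynomial.X : Polynomial ℝ) ^ d l) • (D l).map Polynomial.C := by
    rw [Finset.sum_mul, Finset.mul_sum]
    refine Finset.sum_congr rfl fun l _ => ?_
    rw [Matrix.smul_mul, Matrix.mul_smul, ← Matrix.map_mul, hSU, Matrix.map_mul]
  have h := congrArg Matrix.det key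
  rw [Matrix.det_mul, Matrix.det_mul, mul_comm (U.map Polynomial.C).det] at h
  exact mul_right_cancel₀ hdet h

/-- Simultaneous diagonalisation of pairwise commuting real symmetric matrices, in matrix
form: there are an invertible real matrix `U` (its columns are a basis of joint eigenvectors)
and eigenvalue lists `γ l` with `S l * U = U * diagonal (γ l)` for every `l`.  From Mathlib's
joint-eigenspace decomposition `LinearMap.IsSymmetric.directSum_isInternal_of_pairwise_commute`
on `EuclideanSpace ℝ (Fin m)` and `DirectSum.IsInternal.collectedBasis`. -/
theorem exists_jointEigenmatrix {K m : ℕ} (S : Fin K → Matrix (Fin m) (Fin m) ℝ)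
    (hS : ∀ l, (S l).IsSymm) (hcomm : ∀ l l', S l * S l' = S l' * S l) :
    ∃ (U : Matrix (Fin m) (Fin m) ℝ) (γ : Fin K → Fin m → ℝ),
      IsUnit U ∧ ∀ l, S l * U = U * Matrix.diagonal (γ l) := by
  classical
  -- the commuting symmetric operators on Euclidean space
  set T : Fin K → (EuclideanSpace ℝ (Fin m) →ₗ[ℝ] EuclideanSpace ℝ (Fin m)) :=
    fun l => Matrix.toEuclideanLin (S l) with hT_def
  have hT : ∀ l, (T l).IsSymmetric := fun l =>
    Matrix.isSymmetric_toEuclideanLin_iff.mpr (Matrix.isHermitian_iff_isSymm.mpr (hS l))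
  have hC : Pairwise (Function.onFun Commute T) := by
    intro l l' _
    change T l * T l' = T l' * T l
    simp only [hT_def, Module.End.mul_eq_comp, ← Matrix.toLpLin_mul_same, hcomm l l']
  have hV := LinearMap.IsSymmetric.directSum_isInternal_of_pairwise_commute hT hC
  -- a basis of joint eigenvectors, indexed by `Fin m`
  let b := hV.collectedBasis fun χ => Module.finBasis ℝ
    (⨅ l, Module.End.eigenspace (T l) (χ l) : Submodule ℝ (EuclideanSpace ℝ (Fin m)))
  letI : Fintype (Σ χ : Fin K → ℝ, Fin (Module.finrank ℝ
      (⨅ l, Module.End.eigenspace (T l) (χ l) : Submodule ℝ (EuclideanSpace ℝ (Fin m))))) :=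
    FiniteDimensional.fintypeBasisIndex b
  have hcard : Fintype.card (Σ χ : Fin K → ℝ, Fin (Module.finrank ℝ
      (⨅ l, Module.End.eigenspace (T l) (χ l) : Submodule ℝ (EuclideanSpace ℝ (Fin m))))) = m := by
    rw [← Module.finrank_eq_card_basis b, finrank_euclideanSpace_fin]
  let e := Fintype.equivFinOfCardEq hcard
  let b' := b.reindex e
  -- every basis vector is an eigenvector of every `T l`
  have hb' : ∀ j l, T l (b' j) = (e.symm j).1 l • b' j := by
    intro j l
    have hmem : b' j ∈ (⨅ l, Module.End.eigenspace (T l) ((e.symm j).1 l) :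
        Submodule ℝ (EuclideanSpace ℝ (Fin m))) := by
      rw [Module.Basis.reindex_apply]
      exact hV.collectedBasis_mem _ _
    exact Module.End.mem_eigenspace_iff.mp ((Submodule.mem_iInf _).mp hmem l)
  refine ⟨(Matrix.of fun j => WithLp.ofLp (b' j))ᵀ, fun l j => (e.symm j).1 l, ?_, ?_⟩
  · -- the columns form a basis, so the matrix is invertible
    rw [Matrix.isUnit_transpose, ← Matrix.linearIndependent_rows_iff_isUnit]
    exact b'.linearIndependent.map' (WithLp.linearEquiv 2 ℝ (Fin m → ℝ)).toLinearMap
      (LinearEquiv.ker _)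
  · -- column `j` of `S l * U` is `S l *ᵥ b' j = γ l j • b' j`
    intro l
    ext i j
    have h := congrArg (fun v : EuclideanSpace ℝ (Fin m) => WithLp.ofLp v i) (hb' j l)
    simp only [hT_def, Matrix.ofLp_toLpLin, Matrix.toLin'_apply, WithLp.ofLp_smul,
      Pi.smul_apply, smul_eq_mul, Matrix.mulVec, dotProduct] at h
    rw [Matrix.mul_diagonal, Matrix.mul_apply]
    simp only [Matrix.transpose_apply, Matrix.of_apply]
    rw [h, mul_comm]

end StubCommutingSector

/-- **Registered stub `stub_commutingSector`** (the commuting sector of the matrix Descartes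
rule): for pairwise commuting real symmetric `m × m` matrices `Sₗ`, the lacunary pencil
`det (∑ₗ X^{dₗ} Sₗ)` has at most `m (K - 1)` distinct positive zeros.  Commuting symmetric
matrices are simultaneously diagonalisable (`StubCommutingSector.exists_jointEigenmatrix`),
the determinant of the pencil is that of the conjugated diagonal pencil
(`StubCommutingSector.det_pencil_eq_of_intertwine`), and the latter is the diagonal sector
`stub_diagonalSector` (a product of `m` polynomials with at most `K` monomials each, sparse
Descartes rule factor by factor). -/
theorem stub_commutingSector (K m : ℕ) (d : Fin K → ℕ) (S : Fin K → Matrix (Fin m) (Fin m) ℝ)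
    (hS : ∀ l, (S l).IsSymm) (hcomm : ∀ l l', S l * S l' = S l' * S l) :
    ((Matrix.det (∑ l, ((Polynomial.X : Polynomial ℝ) ^ d l) • (S l).map Polynomial.C)).roots.toFinset.filter
        (fun t => 0 < t)).card ≤ m * (K - 1) := by
  obtain ⟨U, γ, hU, hSU⟩ := StubCommutingSector.exists_jointEigenmatrix S hS hcomm
  rw [StubCommutingSector.det_pencil_eq_of_intertwine d S (fun l => Matrix.diagonal (γ l)) U
    hU hSU]
  exact stub_diagonalSector K m d γ
end Summit.ValiantsHypothesis.ValiantsHypothesis.Theorems.LacunarySymmetroidMatrixDescartes
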